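import Literature.Topology.CoveringSpaces.CoveringIdRigid
import Literature.Topology.CoveringSpaces.CoveringMonodromyStabilizer
import Literature.AnabelianGeometry.Anabelioids.BCatFullSubcategoryIdRigid
import Mathlib.CategoryTheory.ObjectProperty.Equivalence
import HarnessLib

/-!
# The category of CONNECTED finite covering spaces is id-rigid when `Z(π̂₁) = 1`; the thrice-punctured sphere

Topic `Literature/Topology/CoveringSpaces` — campaign-L R1 (abc-iut cell, GAP row G-L4t14-R1),
the «connected objects» seam of step R1.2: S. Mochizuki, *Topics in Absolute Anabelian Geometry
III*, Prop. 4.2 (i) p. 106 l. 11–19 needs the id-rigidity of «the full subcategory of `EA`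
consisting of objects that map to `X`», a category of CONNECTED finite étale coverings of the
Riemann surface `X`. The tree has `CovFin.isIdRigid_of_isSlimGroup` / `CovFin.isIdRigid_iff_center_eq_bot`
for the category `Cov^fin(X)` of ALL finite covers; an automorphism of the identity of the full
SUBcategory of connected covers is a priori less constrained, so here:

* `CovFin.connectedSpace_of_iso`, `CovFin.isClosedUnderIsomorphisms_connectedSpace` (a theorem,
  not an instance) — isomorphic covers have simultaneously connected total spaces;
* `CovFin.connectedSpace_of_iso_equivBCat` — under abc-iut-w5-d144's
  `CovFin.equivBCat x₀ : Cov^fin(X) ≌ B(π̂₁(X, x₀))`, a cover whose finite `π̂₁`-set is isomorphic to a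
  CONNECTED object of `B(π̂₁)` (nonempty transitive) has connected total space (the `π̂₁`-action on a
  finite set factors through `π₁`, `FiniteActionCompletion.exists_completionSMul_eq`, so the monodromy
  is transitive, hence the total space is path connected by `CoverMonodromy.pathConnectedSpace_of_forall_exists_monodromy_eq`);
* **`CovFin.isIdRigid_connected_of_center_eq_bot`** — for `X` path connected and strongly locally
  contractible with `Z(π̂₁(X, x₀)) = 1`, the full subcategory of `Cov^fin(X)` on the covers with
  CONNECTED total space is id-rigid: Mathlib's `Equivalence.congrFullSubcategory` carries it to a full
  subcategory of `B(π̂₁)` containing the coset objects, id-rigid by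
  `isIdRigid_fullSubcategory_bCat_of_center_eq_bot`; `…_of_isSlimGroup` (slim ⇒ centre-free);
* **`CovFin.isIdRigid_connected_compl_finite`**, `CovFin.isIdRigid_connected_thricePuncturedSphere` —
  unconditionally for `X = ℂ ∖ F`, `F` finite with `2 ≤ |F|` (free `π₁` of rank `≥ 2`, slim
  profinite completion: the tree's `isSlimGroup_profiniteCompletion_fundamentalGroup_compl_finite`).

Everything is proved; no definitions, no instances, no named facts. Classical; nothing here bears
on [IUTchIII] Cor. 3.12.

## References

* S. Mochizuki, *Topics in Absolute Anabelian Geometry III*, §0 p. 27, Prop. 4.2 (i) p. 106.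
  [MochizukiAbsTopIII2015]
* S. Mochizuki, *Semi-graphs of anabelioids*, §0 p. 6. [MochizukiSemiAnbd2006]
* A. Hatcher, *Algebraic Topology*, CUP 2002, §1.3 Thm. 1.38. [HatcherAT2002]
-/

noncomputable section

open CategoryTheory Set Function
open Literature.AlgebraicGeometry.Frobenioids (BCat IsSlimGroup)
open Literature.AnabelianGeometry.AbsoluteAnabelian (IsIdRigid isIdRigid_of_equivalence)
open Literature.AnabelianGeometry.Anabelioids
open Literature.IUT.HodgeTheaters (profiniteCompletion)
open Literature.GroupTheory

universe u

namespace Literature.Topology.CoveringSpaces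

namespace CovFin

/-! ### §1 «Connected total space» is invariant under isomorphism of covers -/

section IsoClosed

variable {X : Type u} [TopologicalSpace X]

/-- The two composites of an isomorphism of `Cov^fin(X)` are the identity on points of the total
spaces. [cite: HatcherAT2002, §1.3 Thm. 1.38] -/
theorem iso_inv_hom_left_apply {E F : CovFin X} (i : E ≅ F) (e : E.obj.left) :
    (i.inv.hom.left : F.obj.left → E.obj.left) ((i.hom.hom.left : E.obj.left → F.obj.left) e) = e := by
  have h := congrArg (fun φ : E ⟶ E => (φ.hom.left : E.obj.left → E.obj.left) e) i.hom_inv_id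
  exact h

/-- An isomorphism of finite covers is surjective on total spaces. [cite: HatcherAT2002, §1.3 Thm. 1.38] -/
theorem surjective_hom_left_of_iso {E F : CovFin X} (i : E ≅ F) :
    Surjective (i.hom.hom.left : E.obj.left → F.obj.left) :=
  fun f => ⟨(i.inv.hom.left : F.obj.left → E.obj.left) f, iso_inv_hom_left_apply i.symm f⟩

/-- **Isomorphic finite covers have simultaneously connected total spaces** (an isomorphism over
`X` is a homeomorphism of total spaces; here: a continuous surjection).
[cite: HatcherAT2002, §1.3 Thm. 1.38] -/
theorem connectedSpace_of_iso {E F : CovFin X} (i : E ≅ F) (hE : ConnectedSpace E.obj.left) :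
    ConnectedSpace F.obj.left :=
  (surjective_hom_left_of_iso i).connectedSpace (continuous_hom i.hom)

/-- The object property «connected total space» of `Cov^fin(X)` is closed under isomorphisms
(stated as a theorem; install with `haveI` where an instance is wanted).
[cite: HatcherAT2002, §1.3 Thm. 1.38] -/
theorem isClosedUnderIsomorphisms_connectedSpace :
    ObjectProperty.IsClosedUnderIsomorphisms (fun E : CovFin X => ConnectedSpace E.obj.left) :=
  ⟨fun i hE => connectedSpace_of_iso i hE⟩

end IsoClosed

/-! ### §2 Covers whose `π̂₁`-set is connected have connected total space -/

section Connected

variable {X : Type u} [TopologicalSpace X] [PathConnectedSpace X] [StronglyLocallyContractibleSpace X]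
  (x₀ : X)

/-- A morphism of `B(π̂₁)` out of the `π̂₁`-set of a cover is `π̂₁`-equivariant, with the `π̂₁`-action
on the fibre being `FiniteActionCompletion.completionSMul` (the extension of the monodromy).
[cite: MochizukiAbsTopIII2015, Definition 4.1 (iii) p.103] -/
theorem equivBCat_hom_completionSMul (E : CovFin X)
    {V : BCat (profiniteCompletion (FundamentalGroup X x₀))}
    (f : (equivBCat x₀).functor.obj E ⟶ V) (x : profiniteCompletion (FundamentalGroup X x₀))
    (q : E.proj ⁻¹' {x₀}) :
    f.hom.hom (FiniteActionCompletion.completionSMul (G := FundamentalGroup X x₀)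
        (S := ((fibreFunctor x₀).obj E).V) x q) = x • f.hom.hom q := by
  have h := Induction.hom_smul f.hom x q
  exact h

/-- **A finite cover whose `π̂₁`-set is isomorphic to a nonempty transitive one has CONNECTED total
space**: the `π̂₁`-action on a finite set factors through `π₁`
(`FiniteActionCompletion.exists_completionSMul_eq`), so the monodromy of `π₁(X, x₀)` on the fibre is
transitive and the total space is path connected (`CoverMonodromy.pathConnectedSpace_of_forall_exists_monodromy_eq`).
[cite: HatcherAT2002, §1.3 Thm. 1.38] -/
theorem connectedSpace_of_iso_equivBCat (E : CovFin X)
    {V : BCat (profiniteCompletion (FundamentalGroup X x₀))}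
    (φ : (equivBCat x₀).functor.obj E ≅ V) (hne : Nonempty V.obj.V)
    (htr : MulAction.IsPretransitive (profiniteCompletion (FundamentalGroup X x₀)) V.obj.V) :
    ConnectedSpace E.obj.left := by
  -- the underlying functions of `φ`
  let f : E.proj ⁻¹' {x₀} → V.obj.V := fun q => φ.hom.hom.hom q
  let g : V.obj.V → E.proj ⁻¹' {x₀} := fun v => φ.inv.hom.hom v
  have hgf : ∀ q, g (f q) = q := fun q => by
    have h := congrArg (fun ψ : (equivBCat x₀).functor.obj E ⟶ (equivBCat x₀).functor.obj E =>
      ψ.hom.hom q) φ.hom_inv_id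
    exact h
  have hf : Injective f := fun q q' h => by rw [← hgf q, ← hgf q', h]
  -- the fibre is nonempty, hence so is the total space
  obtain ⟨v⟩ := hne
  haveI : Nonempty E.obj.left := ⟨(g v).1⟩
  -- the monodromy is transitive
  refine @PathConnectedSpace.connectedSpace _ _
    (CoverMonodromy.pathConnectedSpace_of_forall_exists_monodromy_eq E.isCoveringMap_proj x₀
      fun q q' => ?_)
  obtain ⟨x, hx⟩ := htr.exists_smul_eq (f q) (f q')
  obtain ⟨γ, hγ⟩ := FiniteActionCompletion.exists_completionSMul_eq (G := FundamentalGroup X x₀)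
    (S := ((fibreFunctor x₀).obj E).V) x
  refine ⟨γ, hf ?_⟩
  have h1 : f (FiniteActionCompletion.completionSMul (G := FundamentalGroup X x₀)
      (S := ((fibreFunctor x₀).obj E).V) x q) = x • f q :=
    equivBCat_hom_completionSMul x₀ E φ.hom x q
  rw [hγ q] at h1
  -- the `π₁`-action on the finite fibre `π₁`-set IS the monodromy (`fibreFunctor_obj_ρ_apply`, rfl)
  exact h1.trans hx

end Connected

/-! ### §3 The connected finite covers form an id-rigid category when `Z(π̂₁) = 1` -/

section IdRigid

variable {X : Type u} [TopologicalSpace X] [PathConnectedSpace X] [StronglyLocallyContractibleSpace X]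
  (x₀ : X)

/-- The essential image, under `Cov^fin(X) ≌ B(π̂₁)`, of «connected total space» pulled back along
the functor is again «connected total space» (the functor is fully faithful and the property is
closed under isomorphisms). [cite: MochizukiAbsTopIII2015, Section 0 p.27] -/
theorem inverseImage_map_connectedSpace :
    (ObjectProperty.map (fun E : CovFin X => ConnectedSpace E.obj.left) (equivBCat x₀).functor).inverseImage
        (equivBCat x₀).functor =
      fun E : CovFin X => ConnectedSpace E.obj.left := by
  funext E
  apply propext
  constructor
  · rintro ⟨E', hE', ⟨i⟩⟩
    exact connectedSpace_of_iso ((equivBCat x₀).functor.preimageIso i) hE'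
  · intro hE
    exact ObjectProperty.prop_map_obj _ _ hE

/-- **`Z(π̂₁(X, x₀)) = 1` ⇒ THE CATEGORY OF CONNECTED FINITE COVERING SPACES OF `X` IS ID-RIGID**:
every automorphism of the identity functor of the full subcategory of `Cov^fin(X)` on the covers
with connected total space is trivial (`X` path connected, strongly locally contractible). This is
the shape of [AbsTopIII] Prop. 4.2 (i) («the full subcategory … of objects that map to `X`»), at
the topological level and with Lemma 4.3's slimness weakened to centre-freeness.
[cite: MochizukiAbsTopIII2015, Proposition 4.2 (i) p.106] -/
theorem isIdRigid_connected_of_center_eq_bot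
    (hZ : Subgroup.center (profiniteCompletion (FundamentalGroup X x₀)) = ⊥) :
    IsIdRigid (ObjectProperty.FullSubcategory fun E : CovFin X => ConnectedSpace E.obj.left) := by
  let e := equivBCat (X := X) x₀
  let Q : ObjectProperty (BCat (profiniteCompletion (FundamentalGroup X x₀))) :=
    ObjectProperty.map (fun E : CovFin X => ConnectedSpace E.obj.left) e.functor
  -- the coset objects lie in the essential image of the connected covers
  have hQ : ∀ (K : OpenNormalSubgroup (profiniteCompletion (FundamentalGroup X x₀)))
      [Finite (profiniteCompletion (FundamentalGroup X x₀) ⧸ K.toSubgroup)],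
      Q (Induction.quotObj K.toSubgroup K.isOpen') := by
    intro K _
    refine ⟨e.inverse.obj (Induction.quotObj K.toSubgroup K.isOpen'), ?_, ⟨e.counitIso.app _⟩⟩
    obtain ⟨hne, htr⟩ := nonempty_and_isPretransitive_quotObj
      (G := profiniteCompletion (FundamentalGroup X x₀)) K.toSubgroup K.isOpen'
    exact connectedSpace_of_iso_equivBCat x₀ _ (e.counitIso.app _) hne htr
  have hrig : IsIdRigid Q.FullSubcategory :=
    isIdRigid_fullSubcategory_bCat_of_center_eq_bot hZ Q hQ
  exact isIdRigid_of_equivalence (e.congrFullSubcategory (inverseImage_map_connectedSpace x₀)) hrig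

/-- `π̂₁(X, x₀)` SLIM ⇒ the category of connected finite covering spaces of `X` is id-rigid
([AbsTopIII] Lemma 4.3's input; slim ⇒ centre-free). [cite: MochizukiAbsTopIII2015, Lemma 4.3 p.106] -/
theorem isIdRigid_connected_of_isSlimGroup
    (h : IsSlimGroup (profiniteCompletion (FundamentalGroup X x₀))) :
    IsIdRigid (ObjectProperty.FullSubcategory fun E : CovFin X => ConnectedSpace E.obj.left) := by
  refine isIdRigid_connected_of_center_eq_bot x₀ ?_
  have h1 := h.centralizer_eq_bot ⊤ isOpen_univ
  rwa [Subgroup.coe_top, Subgroup.centralizer_univ] at h1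

end IdRigid

/-! ### §4 The thrice-punctured sphere -/

/-- **The category of CONNECTED finite covering spaces of `ℂ ∖ F` is id-rigid** for every finite
`F ⊆ ℂ` with at least two points (`π₁` free of rank `|F| ≥ 2`, with slim profinite completion).
[cite: MochizukiAbsTopIII2015, Proposition 4.2 (i) p.106] -/
theorem isIdRigid_connected_compl_finite {F : Set ℂ} (hF : F.Finite) (h2 : 2 ≤ F.ncard) :
    IsIdRigid (ObjectProperty.FullSubcategory fun E : CovFin ↥(Fᶜ) => ConnectedSpace E.obj.left) := by
  haveI := pathConnectedSpace_compl_finite hF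
  haveI := stronglyLocallyContractibleSpace_compl_finite hF
  obtain ⟨x⟩ : Nonempty ↥(Fᶜ) := inferInstance
  exact isIdRigid_connected_of_isSlimGroup x
    (isSlimGroup_profiniteCompletion_fundamentalGroup_compl_finite hF h2 x)

/-- **The connected finite covers of the thrice-punctured sphere `ℂ ∖ {0, 1}` form an id-rigid
category.** [cite: MochizukiAbsTopIII2015, Proposition 4.2 (i) p.106] -/
theorem isIdRigid_connected_thricePuncturedSphere :
    IsIdRigid (ObjectProperty.FullSubcategory
      fun E : CovFin ↥(({0, 1} : Set ℂ)ᶜ) => ConnectedSpace E.obj.left) :=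
  isIdRigid_connected_compl_finite (Set.toFinite _) (by
    rw [Set.ncard_pair (zero_ne_one' ℂ)])

end CovFin

end Literature.Topology.CoveringSpaces
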